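import Mathlib
import Summits.Ventures.PercRepro2.SkeletonNbr
import Summits.Ventures.PercRepro2.SkeletonPathMark
import Summits.Ventures.PercRepro2.HMFSwap
import Summits.Ventures.PercRepro2.HMFIsolated

/-!
# (HCOV) with at most one unmarked branch vertex (blind cell PercRepro2, night-1 g16;
NIGHT1-G16.md §5′)

**`HMF_of_one_branch`** / **`HCov_of_one_branch`**: let `u` be an unmarked vertex such that every
OTHER unmarked vertex has at most two nonzero neighbours, and let `a₃` have at most one nonzero
neighbour.  Then (HMF), hence (HCOV), holds.
In the Simple reduct every unmarked vertex other than `u` has no nonzero edge (three distinct nonzero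
neighbours otherwise), `a₃` has at most one nonzero edge (a second one would be parallel), and the
far end of that edge is a mark (the pendant map: `HCov_of_reduces_leaf_at_*`), the hub `u` (every
other nonzero edge at `u` then goes to `a₃` or a mark: `HCov_of_reduces_leaf_hub`), or there is no
edge at all (`HMFIsolated.HMF_isolated`; at (HCOV) strength also class R₃ vacuously).  The
pendant-at-`a₁` case is `HMFSwap.HMF_pendant_root'` (the root symmetry of `HMFc`).  The subdivided
hub — `u` joined to the marks and to `a₃` by paths of unmarked degree-two vertices, with any further
cycles through marks — is an instance.

Own code; standard axioms.
-/

open scoped Classical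

namespace Summit.Ventures.PercRepro2

open UnionCluster CovForm

namespace Skeleton

section OneBranch

variable {V : Type*} {E : Type*} [Fintype E] [DecidableEq E] [Fintype V] [DecidableEq V]
  {R : Type*} [Field R] [LinearOrder R] [IsStrictOrderedRing R]

variable {o a₁ a₂ a₃ b : V}

omit [DecidableEq E] [LinearOrder R] [IsStrictOrderedRing R] in
/-- In a simple instance, an unmarked vertex with at most two nonzero neighbours has no nonzero
edge. -/
lemma notMem_of_simple_of_card_nzNbr_le_two {q : E → R} {ends' : E → Sym2 V}
    (hs : Simple q ends' o a₁ a₂ a₃ b) {y : V} (hyo : y ≠ o) (hy1 : y ≠ a₁) (hy2 : y ≠ a₂)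
    (hy3 : y ≠ a₃) (hyb : y ≠ b) (hle : (nzNbr q ends' y).card ≤ 2) {e : E} (he : q e ≠ 0)
    (hye : y ∈ ends' e) : False := by
  obtain ⟨hred, -, hnopar⟩ := hs
  have hs := (hred y hyo hy1 hy2 hy3 hyb).2
  have hpos : 1 ≤ nzDeg q ends' y := by
    rw [nzDeg_eq_card]
    exact Finset.card_pos.2 ⟨e, mem_nzAt.2 ⟨hye, he⟩⟩
  have h3 : 2 < nzDeg q ends' y := by rcases hs with h0 | h3 <;> omega
  rw [nzDeg_eq_card, Finset.two_lt_card] at h3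
  obtain ⟨e₁, h1, e₂, h2, e₃, h3', h12, h13, h23⟩ := h3
  rw [mem_nzAt] at h1 h2 h3'
  obtain ⟨y₁, hy₁⟩ := Sym2.mem_iff_exists.1 h1.1
  obtain ⟨y₂, hy₂⟩ := Sym2.mem_iff_exists.1 h2.1
  obtain ⟨y₃, hy₃⟩ := Sym2.mem_iff_exists.1 h3'.1
  have hne : ∀ {ea eb : E} {ya yb : V}, q ea ≠ 0 → q eb ≠ 0 → ea ≠ eb → ends' ea = s(y, ya) →
      ends' eb = s(y, yb) → ya ≠ yb := by
    intro ea eb ya yb ha hb hab hea heb hyy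
    exact hnopar ea eb ha hb hab (by rw [hea, heb, hyy])
  have hsub : ({y₁, y₂, y₃} : Finset V) ⊆ nzNbr q ends' y := by
    intro z hz
    simp only [Finset.mem_insert, Finset.mem_singleton] at hz
    rw [mem_nzNbr]
    rcases hz with rfl | rfl | rfl
    · exact ⟨e₁, h1.2, hy₁⟩
    · exact ⟨e₂, h2.2, hy₂⟩
    · exact ⟨e₃, h3'.2, hy₃⟩
  have hcard : ({y₁, y₂, y₃} : Finset V).card = 3 := by
    rw [Finset.card_insert_of_notMem, Finset.card_insert_of_notMem, Finset.card_singleton]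
    · simpa using hne h2.2 h3'.2 h23 hy₂ hy₃
    · simp only [Finset.mem_insert, Finset.mem_singleton, not_or]
      exact ⟨hne h1.2 h2.2 h12 hy₁ hy₂, hne h1.2 h3'.2 h13 hy₁ hy₃⟩
  have := Finset.card_le_card hsub
  omega

/-- **(HCOV) with at most one unmarked branch vertex**: `u` unmarked, every other unmarked vertex
with at most two nonzero neighbours, `a₃` with at most one nonzero neighbour, the five marks
distinct ⊢ (HCOV). -/
theorem HCov_of_one_branch (p : E → R) (ends : E → Sym2 V) (hp : IsProbVec p) (u : V)
    (huo : u ≠ o) (hu1 : u ≠ a₁) (hu2 : u ≠ a₂) (hu3 : u ≠ a₃) (hub : u ≠ b)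
    (hinj : Function.Injective (Hub3.markOf3 o a₁ a₂ a₃ b))
    (hnbr : ∀ v, v ≠ u → v ≠ o → v ≠ a₁ → v ≠ a₂ → v ≠ a₃ → v ≠ b → (nzNbr p ends v).card ≤ 2)
    (h3 : (nzNbr p ends a₃).card ≤ 1) :
    HCov p ends o a₁ a₂ a₃ b := by
  have h31 : a₃ ≠ a₁ := hinj.ne (by decide : Hub.Mark.a₃ ≠ Hub.Mark.a₁)
  have h32 : a₃ ≠ a₂ := hinj.ne (by decide : Hub.Mark.a₃ ≠ Hub.Mark.a₂)
  have h3o : a₃ ≠ o := hinj.ne (by decide : Hub.Mark.a₃ ≠ Hub.Mark.o)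
  have h3b : a₃ ≠ b := hinj.ne (by decide : Hub.Mark.a₃ ≠ Hub.Mark.b)
  obtain ⟨J, hJ, hJs⟩ := exists_reduces_simple o a₁ a₂ a₃ b p ends hp
  obtain ⟨q, ends'⟩ := J
  have hq : IsProbVec q := isProbVec_of_reduces (I := (p, ends)) hJ hp
  -- every unmarked vertex other than `u` has no nonzero edge in the reduct
  have hiso : ∀ v, v ≠ u → v ≠ o → v ≠ a₁ → v ≠ a₂ → v ≠ a₃ → v ≠ b → ∀ e, q e ≠ 0 →
      v ∉ ends' e := by
    intro v hvu hvo hv1 hv2 hv3 hvb e he hve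
    exact notMem_of_simple_of_card_nzNbr_le_two hJs hvo hv1 hv2 hv3 hvb
      (le_trans (card_nzNbr_le_of_reduces (I := (p, ends)) (J := (q, ends')) hJ v)
        (hnbr v hvu hvo hv1 hv2 hv3 hvb)) he hve
  have h3' : (nzNbr q ends' a₃).card ≤ 1 :=
    le_trans (card_nzNbr_le_of_reduces (I := (p, ends)) (J := (q, ends')) hJ a₃) h3
  obtain ⟨-, hnoloop, hnopar⟩ := hJs
  dsimp only at hnoloop hnopar
  by_cases hex : ∃ e, q e ≠ 0 ∧ a₃ ∈ ends' e
  · obtain ⟨f, hqf, haf⟩ := hex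
    obtain ⟨y, hy⟩ := Sym2.mem_iff_exists.1 haf
    have hy3 : y ≠ a₃ := by
      intro hh; subst hh
      exact hnoloop f hqf (by rw [hy]; exact Sym2.mk_isDiag_iff.2 rfl)
    -- every nonzero edge at `a₃` is `f`: its far end is `y` (one neighbour), so it is parallel to `f`
    have hleaf : ∀ e, q e ≠ 0 → a₃ ∈ ends' e → e = f := by
      intro e he hae
      obtain ⟨z, hz⟩ := Sym2.mem_iff_exists.1 hae
      have hyz : y = z := by
        by_contra hyz
        have hsub : ({y, z} : Finset V) ⊆ nzNbr q ends' a₃ := by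
          intro w hw
          simp only [Finset.mem_insert, Finset.mem_singleton] at hw
          rw [mem_nzNbr]
          rcases hw with rfl | rfl
          · exact ⟨f, hqf, hy⟩
          · exact ⟨e, he, hz⟩
        have := Finset.card_le_card hsub
        rw [Finset.card_pair hyz] at this
        omega
      subst hyz
      by_contra hef
      exact hnopar e f he hqf hef (by rw [hz, hy])
    -- the far end `y` is a mark or the hub `u`
    by_cases hyu : y = u
    · subst hyu
      refine HCov_of_reduces_leaf_hub hp hJ hy hqf hleaf ?_ hy3.symm h3o h31 h32 h3b hu1 hu2 huo hub
      intro e he hue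
      obtain ⟨z, hz⟩ := Sym2.mem_iff_exists.1 hue
      by_cases hzu : z = y
      · exfalso; subst hzu
        exact hnoloop e he (by rw [hz]; exact Sym2.mk_isDiag_iff.2 rfl)
      by_cases hz3 : z = a₃
      · left; rw [hz, hz3]
      by_cases hz1 : z = a₁
      · right; left; rw [hz, hz1]
      by_cases hz2 : z = a₂
      · right; right; left; rw [hz, hz2]
      by_cases hzo : z = o
      · right; right; right; left; rw [hz, hzo]
      by_cases hzb : z = b
      · right; right; right; right; left; rw [hz, hzb]
      exfalso
      exact hiso z hzu hzo hz1 hz2 hz3 hzb e he (by rw [hz]; exact Sym2.mem_mk_right y z)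
    · by_cases hy1 : y = a₁
      · rw [hy1] at hy
        exact HCov_of_reduces_leaf_at_root1 hp hJ hy hqf hleaf h31 h32 h3o.symm h3b.symm
      by_cases hy2 : y = a₂
      · rw [hy2] at hy
        exact HCov_of_HMF p hp ends o a₁ a₂ a₃ b
          (HMF_of_reduces_leaf_at_root2 hp hJ hy hqf hleaf h32 h31 h3o.symm h3b.symm)
      by_cases hyo : y = o
      · rw [hyo] at hy
        exact HCov_of_HMF p hp ends o a₁ a₂ a₃ b
          (HMF_of_reduces_leaf_at_o hp hJ hy hqf hleaf h3o h31 h32 h3b.symm)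
      by_cases hyb : y = b
      · rw [hyb] at hy
        exact HCov_of_HMF p hp ends o a₁ a₂ a₃ b
          (HMF_of_reduces_leaf_at_b hp hJ hy hqf hleaf h3b h31 h32 h3o.symm)
      exfalso
      exact hiso y hyu hyo hy1 hy2 hy3 hyb f hqf (by rw [hy]; exact Sym2.mem_mk_right a₃ y)
  · -- no nonzero edge at `a₃`: class R₃ vacuously
    refine HCov_of_reduces_marks_at_a3 hp hJ hinj ?_
    intro e he hae
    exact absurd ⟨e, he, hae⟩ hex

/-- **`a₃` pendant at the root `a₁` modulo reduction** (HMF, by the root symmetry of `HMFc`). -/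
theorem HMF_of_reduces_leaf_at_root1 {p : E → R} {ends : E → Sym2 V} (hp : IsProbVec p)
    {q : E → R} {ends' : E → Sym2 V} (h : Reduces o a₁ a₂ a₃ b (p, ends) (q, ends'))
    {f : E} (hf : ends' f = s(a₃, a₁)) (hqf : q f ≠ 0)
    (hleaf : ∀ e, q e ≠ 0 → a₃ ∈ ends' e → e = f)
    (h31 : a₃ ≠ a₁) (h32 : a₃ ≠ a₂) (ho : o ≠ a₃) (hb : b ≠ a₃) :
    HMF p ends o a₁ a₂ a₃ b := by
  obtain ⟨hf'', hleaf''⟩ := leaf_reroute (a₁ := a₂) q ends' hf hqf hleaf h32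
  have h' : Reduces o a₁ a₂ a₃ b (p, ends) (q, reroute q ends' a₂) :=
    Relation.ReflTransGen.tail h (Step.reroute fun _ he => (reroute_of_ne q ends' a₂ he).symm)
  exact HMF_of_reduces (I := (p, ends)) h' hp
    (HMFSwap.HMF_pendant_root' q _ (isProbVec_of_reduces (I := (p, ends)) h hp) hf'' hleaf'' h31 h32
      ho hb)

/-- **`a₃` without a nonzero edge modulo reduction** (HMF: the mean field is exact there). -/
theorem HMF_of_reduces_isolated {p : E → R} {ends : E → Sym2 V} (hp : IsProbVec p)
    {q : E → R} {ends' : E → Sym2 V} (h : Reduces o a₁ a₂ a₃ b (p, ends) (q, ends'))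
    (hiso : ∀ e, q e ≠ 0 → a₃ ∉ ends' e)
    (h31 : a₃ ≠ a₁) (h32 : a₃ ≠ a₂) (ho : o ≠ a₃) (hb : b ≠ a₃) :
    HMF p ends o a₁ a₂ a₃ b := by
  have h' : Reduces o a₁ a₂ a₃ b (p, ends) (q, reroute q ends' a₁) :=
    Relation.ReflTransGen.tail h (Step.reroute fun _ he => (reroute_of_ne q ends' a₁ he).symm)
  refine HMF_of_reduces (I := (p, ends)) h' hp ?_
  refine HMFIsolated.HMF_isolated _ q ?_ h31.symm h32.symm ho hb
  intro e he
  dsimp only at he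
  have hqe : q e ≠ 0 := ne_zero_of_mem_reroute q ends' h31 he
  rw [reroute_of_ne q ends' a₁ hqe] at he
  exact hiso e hqe he

/-- **(HMF) with at most one unmarked branch vertex**: `u` unmarked, every other unmarked vertex
with at most two nonzero neighbours, `a₃` with at most one nonzero neighbour, the five marks
distinct ⊢ (HMF). -/
theorem HMF_of_one_branch (p : E → R) (ends : E → Sym2 V) (hp : IsProbVec p) (u : V)
    (huo : u ≠ o) (hu1 : u ≠ a₁) (hu2 : u ≠ a₂) (hu3 : u ≠ a₃) (hub : u ≠ b)
    (hinj : Function.Injective (Hub3.markOf3 o a₁ a₂ a₃ b))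
    (hnbr : ∀ v, v ≠ u → v ≠ o → v ≠ a₁ → v ≠ a₂ → v ≠ a₃ → v ≠ b → (nzNbr p ends v).card ≤ 2)
    (h3 : (nzNbr p ends a₃).card ≤ 1) :
    HMF p ends o a₁ a₂ a₃ b := by
  have h31 : a₃ ≠ a₁ := hinj.ne (by decide : Hub.Mark.a₃ ≠ Hub.Mark.a₁)
  have h32 : a₃ ≠ a₂ := hinj.ne (by decide : Hub.Mark.a₃ ≠ Hub.Mark.a₂)
  have h3o : a₃ ≠ o := hinj.ne (by decide : Hub.Mark.a₃ ≠ Hub.Mark.o)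
  have h3b : a₃ ≠ b := hinj.ne (by decide : Hub.Mark.a₃ ≠ Hub.Mark.b)
  obtain ⟨J, hJ, hJs⟩ := exists_reduces_simple o a₁ a₂ a₃ b p ends hp
  obtain ⟨q, ends'⟩ := J
  have hiso : ∀ v, v ≠ u → v ≠ o → v ≠ a₁ → v ≠ a₂ → v ≠ a₃ → v ≠ b → ∀ e, q e ≠ 0 →
      v ∉ ends' e := by
    intro v hvu hvo hv1 hv2 hv3 hvb e he hve
    exact notMem_of_simple_of_card_nzNbr_le_two hJs hvo hv1 hv2 hv3 hvb
      (le_trans (card_nzNbr_le_of_reduces (I := (p, ends)) (J := (q, ends')) hJ v)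
        (hnbr v hvu hvo hv1 hv2 hv3 hvb)) he hve
  have h3' : (nzNbr q ends' a₃).card ≤ 1 :=
    le_trans (card_nzNbr_le_of_reduces (I := (p, ends)) (J := (q, ends')) hJ a₃) h3
  obtain ⟨-, hnoloop, hnopar⟩ := hJs
  dsimp only at hnoloop hnopar
  by_cases hex : ∃ e, q e ≠ 0 ∧ a₃ ∈ ends' e
  · obtain ⟨f, hqf, haf⟩ := hex
    obtain ⟨y, hy⟩ := Sym2.mem_iff_exists.1 haf
    have hy3 : y ≠ a₃ := by
      intro hh; subst hh
      exact hnoloop f hqf (by rw [hy]; exact Sym2.mk_isDiag_iff.2 rfl)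
    have hleaf : ∀ e, q e ≠ 0 → a₃ ∈ ends' e → e = f := by
      intro e he hae
      obtain ⟨z, hz⟩ := Sym2.mem_iff_exists.1 hae
      have hyz : y = z := by
        by_contra hyz
        have hsub : ({y, z} : Finset V) ⊆ nzNbr q ends' a₃ := by
          intro w hw
          simp only [Finset.mem_insert, Finset.mem_singleton] at hw
          rw [mem_nzNbr]
          rcases hw with rfl | rfl
          · exact ⟨f, hqf, hy⟩
          · exact ⟨e, he, hz⟩
        have := Finset.card_le_card hsub
        rw [Finset.card_pair hyz] at this
        omega
      subst hyz
      by_contra hef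
      exact hnopar e f he hqf hef (by rw [hz, hy])
    by_cases hyu : y = u
    · subst hyu
      refine HMF_of_reduces_leaf_hub hp hJ hy hqf hleaf ?_ hy3.symm h3o h31 h32 h3b hu1 hu2 huo hub
      intro e he hue
      obtain ⟨z, hz⟩ := Sym2.mem_iff_exists.1 hue
      by_cases hzu : z = y
      · exfalso; subst hzu
        exact hnoloop e he (by rw [hz]; exact Sym2.mk_isDiag_iff.2 rfl)
      by_cases hz3 : z = a₃
      · left; rw [hz, hz3]
      by_cases hz1 : z = a₁
      · right; left; rw [hz, hz1]
      by_cases hz2 : z = a₂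
      · right; right; left; rw [hz, hz2]
      by_cases hzo : z = o
      · right; right; right; left; rw [hz, hzo]
      by_cases hzb : z = b
      · right; right; right; right; left; rw [hz, hzb]
      exfalso
      exact hiso z hzu hzo hz1 hz2 hz3 hzb e he (by rw [hz]; exact Sym2.mem_mk_right y z)
    · by_cases hy1 : y = a₁
      · rw [hy1] at hy
        exact HMF_of_reduces_leaf_at_root1 hp hJ hy hqf hleaf h31 h32 h3o.symm h3b.symm
      by_cases hy2 : y = a₂
      · rw [hy2] at hy
        exact HMF_of_reduces_leaf_at_root2 hp hJ hy hqf hleaf h32 h31 h3o.symm h3b.symm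
      by_cases hyo : y = o
      · rw [hyo] at hy
        exact HMF_of_reduces_leaf_at_o hp hJ hy hqf hleaf h3o h31 h32 h3b.symm
      by_cases hyb : y = b
      · rw [hyb] at hy
        exact HMF_of_reduces_leaf_at_b hp hJ hy hqf hleaf h3b h31 h32 h3o.symm
      exfalso
      exact hiso y hyu hyo hy1 hy2 hy3 hyb f hqf (by rw [hy]; exact Sym2.mem_mk_right a₃ y)
  · -- no nonzero edge at `a₃`: the mean field is exact
    refine HMF_of_reduces_isolated hp hJ ?_ h31 h32 h3o.symm h3b.symm
    intro e he hae
    exact hex ⟨e, he, hae⟩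

end OneBranch

end Skeleton

end Summit.Ventures.PercRepro2
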